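import Summits.QuantumFields.YangMills.Theorems.BalabanUVNodesSpineReadingOfRecord13CoPHKForgive

/-!
# THE FLOOR-VOLUME BAD-KEY READING OF THE SPINE READING OF RECORD — `YMDAG.UVSplit.badKeyReadingOfFloorVolume₁₃ N K₀ c n : BadKeyReading₁₃ N K₀`: a key is BAD iff
# its large-field region ONE LEVEL ABOVE THE FLOOR `c` has at least `n` finest sites (`Node00.largeFieldVolume`), floor and threshold read per tuple AT THE KEY's OWN STEP;
# its dictionary at any dial, and the two dials of record: at the LEVEL window and at the COMPONENT-WISE FORGIVING window threshold `1` IS the level cut one above the floor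

Cell `pub-ymgap`, YM-PLAN Track A (HUMAN RULING D-0062; width push D-0149); seat `pub-ymgap-dag-n20-d` (R134 (a) N20 NE7b s3 = the U5d ∕ `crOfRecord₁₃` lineage) gen 29;
companion of `Thm/BalabanUVNodesSpineReadingOfRecord13CoPHK` (p608328: `BadKeyReading₁₃ ∕ FloorReading₁₃ ∕ classSetK₁₃ ∕ badClassK₁₃ ∕ weightAK₁₃ ∕ crOfRecord₁₃KAt ∕
badKeyReadingOfCut₁₃ ∕ windowKeyReading₁₃`), `…CoPHKForgive` (p617877: `forgiveCompReading₁₃`), `Literature/…/Node00/TwoRunSiteWindow` v1.2 (p616671: `largeFieldVolume`,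
`one_le_largeFieldVolume_windowKey_succ_iff`) and `Node00/TwoRunSiteComponents` (p615381: `forgiveKeyComp(Sigma)`).  `--kind definition --supports stmt-QuantumFields-20544 --as
helper`; COUNT-NEUTRAL.  ASKED BY dag-n20-w2 g4 («WANT» on this seat's OFFER (t11)(b), pub-ymgap INBOX l.32430): their file prices ANY threshold reading `n K ≤ φ K u` on a key
statistic and spells the floor-volume instance as a lambda — ONE declarer of the reading: this file.
WHAT IS HERE.  §1 `fst_eq_of_mem_classSet₁₃` (every class of record at step `K` has step component `K` — so «read at the key's own step» and «read at the ambient step» agree on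
class sets) and the generic membership `mem_classSetK₁₃_iff`; §2 the reading, `_apply`, membership of the coarse bad class at ANY dial (`mem_bad_floorVolume_iff`), threshold
antitonicity (`bad_floorVolume_anti`), the junk guard `bad_floorVolume_zero` (threshold `0` books the whole class set), the bad mass (`sum_bad_floorVolume_weightAK₁₃_eq ∕ …BK`), and
at the reading (`mem_bad_crOfRecord₁₃KAt_floorVolume_iff`); §3 ★ THRESHOLD `1` IS THE LEVEL CUT ONE ABOVE THE FLOOR — at the level-window dial
(`bad_window_floorVolume_one_eq_cut_succ`, by `Node00.one_le_largeFieldVolume_windowKey_succ_iff`) and at the component-wise forgiving dial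
(`one_le_largeFieldVolume_forgiveKeyComp_succ_iff`, `bad_forgive_floorVolume_one_eq_cut_succ`: volume `≥ 1` just above the floor of the FORGIVEN key ⟺ an un-absorbed birth AT
level `c + 1`).
HONEST FRAMING.  A DEFINITION + [folklore] bookkeeping; whether a volume threshold `n(K)` books a summable relative weight is an (AC)-type large-deviation ESTIMATE over correlated
blocks (the (MSP)∕(W♮) wall of the n20-c lineage in window currency) — NOT claimed; nothing of Bałaban's asserted; NE7 ∕ NE7b ∕ NE7c NOT PRINTED for d = 4 ∕ NOT proved; no
`Provisos₁₃CoPH` inhabitant claimed (K0⁷ OPEN); no stub of K3⁷ closed or claimed; N19 ∕ N20 ∕ N21 ∕ N27 NOT discharged; counts UNMOVED (typed 28∕28 · discharged 5∕27); one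
finite four-torus programme at fixed `ε` — NOT ℝ⁴, NOT OS, NOT a mass gap, NOT the Clay problem.  No decl below carries a cite tag.
-/

noncomputable section

open scoped BigOperators
open Finset

namespace YMDAG.UVSplit

open Literature.MathematicalPhysics.QuantumFieldTheory.Balaban1983to89
open Literature.MathematicalPhysics.QuantumFieldTheory.Balaban1983to89.T4Continuum
open Literature.MathematicalPhysics.QuantumFieldTheory.Balaban1983to89.Node00
open T4MatchingAssembly (classVal)

variable {F : T4Family} {N : ℕ} [NeZero N]

/-! ## §1 Every class of record at step `K` has step component `K`; membership in a coarse class set -/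

section Step

variable (θ : Stage13HParams F N) (K₀ : ℕ) (g₀ : ℕ → ℝ)

/-- **EVERY CLASS OF RECORD AT STEP `K` HAS STEP COMPONENT `K`** (`keyA₁₃ ∕ keyB₁₃` pack the step): so a bad-key reading may read its floor ∕ threshold at the key's own step `x.1`
or at the ambient step `K` indifferently on the class set of record. [bookkeeping] -/
theorem fst_eq_of_mem_classSet₁₃ {K : ℕ} {x : Σ K, SiteSeqKey F (K₀ + K)} (hx : x ∈ classSet₁₃ θ K₀ g₀ K) : x.1 = K := by
  letI : ∀ Kc, DecidableEq (SiteSeqKey F Kc) := fun _ => Classical.decEq _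
  unfold classSet₁₃ at hx
  rcases Finset.mem_union.mp hx with h | h
  · obtain ⟨s, -, rfl⟩ := Finset.mem_image.mp h
    rfl
  · obtain ⟨s', -, rfl⟩ := Finset.mem_image.mp h
    unfold keyB₁₃
    split_ifs <;> rfl

/-- Membership in a coarse class set: some class of record reads to it. [bookkeeping] -/
theorem mem_classSetK₁₃_iff (kr : ℕ → (Σ K, SiteSeqKey F (K₀ + K)) → (Σ K, SiteSeqKey F (K₀ + K))) (K : ℕ) (u : Σ K, SiteSeqKey F (K₀ + K)) :
    u ∈ classSetK₁₃ θ K₀ g₀ kr K ↔ ∃ x ∈ classSet₁₃ θ K₀ g₀ K, kr K x = u := by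
  letI : ∀ Kc, DecidableEq (SiteSeqKey F Kc) := fun _ => Classical.decEq _
  exact Finset.mem_image

end Step

/-! ## §2 The reading and its dictionary -/

/-- **THE FLOOR-VOLUME BAD-KEY READING** with floor reading `c` and threshold reading `n`: a key is bad iff its large-field region at the level ONE ABOVE ITS STEP's FLOOR has at least
`n` (of its step) finest sites — floor and threshold read at the key's own step `x.1`. [bookkeeping] -/
def badKeyReadingOfFloorVolume₁₃ (N : ℕ) [NeZero N] (K₀ : ℕ) (c n : FloorReading₁₃ N) : BadKeyReading₁₃ N K₀ :=
  fun F θ hP g₀ os _ x => n F θ hP g₀ os x.1 ≤ largeFieldVolume (c F θ hP g₀ os x.1 + 1) x.2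

section Reading

variable (θ : Stage13HParams F N) (hP : θ.Provisos₁₃CoPH F N) (K₀ : ℕ) (g₀ : ℕ → ℝ) (os : List (ULoop F))
  (kr : ℕ → (Σ K, SiteSeqKey F (K₀ + K)) → (Σ K, SiteSeqKey F (K₀ + K))) (cK nK : ℕ → ℕ)

/-- The reading, unfolded at a tuple. [bookkeeping] -/
theorem badKeyReadingOfFloorVolume₁₃_apply (c n : FloorReading₁₃ N) (K : ℕ) (x : Σ K, SiteSeqKey F (K₀ + K)) :
    badKeyReadingOfFloorVolume₁₃ N K₀ c n F θ hP g₀ os K x ↔ n F θ hP g₀ os x.1 ≤ largeFieldVolume (c F θ hP g₀ os x.1 + 1) x.2 :=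
  Iff.rfl

/-- **MEMBERSHIP OF THE COARSE BAD CLASS AT ANY DIAL** under the floor-volume reading (floors `cK`, thresholds `nK` per step): a coarse class whose key has floor-volume at least the
threshold. [bookkeeping] -/
theorem mem_bad_floorVolume_iff (K : ℕ) (t : ℝ) (u : Σ K, SiteSeqKey F (K₀ + K)) :
    u ∈ badClassK₁₃ θ K₀ g₀ kr (fun _ x => nK x.1 ≤ largeFieldVolume (cK x.1 + 1) x.2) K t ↔
      u ∈ classSetK₁₃ θ K₀ g₀ kr K ∧ nK u.1 ≤ largeFieldVolume (cK u.1 + 1) u.2 :=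
  mem_badClassK₁₃_iff θ K₀ g₀ kr _ K t u

/-- **THRESHOLD ANTITONICITY**: raising the threshold shrinks the bad class. [bookkeeping] -/
theorem bad_floorVolume_anti {nK nK' : ℕ → ℕ} (h : ∀ K, nK K ≤ nK' K) (K : ℕ) (t : ℝ) :
    badClassK₁₃ θ K₀ g₀ kr (fun _ x => nK' x.1 ≤ largeFieldVolume (cK x.1 + 1) x.2) K t ⊆
      badClassK₁₃ θ K₀ g₀ kr (fun _ x => nK x.1 ≤ largeFieldVolume (cK x.1 + 1) x.2) K t := by
  intro u hu
  rw [mem_bad_floorVolume_iff] at hu ⊢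
  exact ⟨hu.1, (h u.1).trans hu.2⟩

/-- JUNK GUARD: threshold `0` books the WHOLE class set (so a `RelWeightBound` there says nothing). [bookkeeping] -/
theorem bad_floorVolume_zero {nK : ℕ → ℕ} (h : ∀ K, nK K = 0) (K : ℕ) (t : ℝ) :
    badClassK₁₃ θ K₀ g₀ kr (fun _ x => nK x.1 ≤ largeFieldVolume (cK x.1 + 1) x.2) K t = classSetK₁₃ θ K₀ g₀ kr K := by
  ext u
  rw [mem_bad_floorVolume_iff, h u.1]
  exact ⟨fun hu => hu.1, fun hu => ⟨hu, Nat.zero_le _⟩⟩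

/-- **THE BAD MASS under the floor-volume reading** (run A): the fine mass of the classes of record whose dialled key has floor-volume at least the threshold. [bookkeeping] -/
theorem sum_bad_floorVolume_weightAK₁₃_eq (K : ℕ) (t : ℝ) :
    ∑ u ∈ badClassK₁₃ θ K₀ g₀ kr (fun _ x => nK x.1 ≤ largeFieldVolume (cK x.1 + 1) x.2) K t, weightAK₁₃ θ hP K₀ g₀ os kr K t u =
      letI : ∀ Kc, DecidableEq (SiteSeqKey F Kc) := fun _ => Classical.decEq _
      ∑ x ∈ (classSet₁₃ θ K₀ g₀ K).filter
          (fun x => kr K x ∈ badClassK₁₃ θ K₀ g₀ kr (fun _ x => nK x.1 ≤ largeFieldVolume (cK x.1 + 1) x.2) K t), weightA₁₃ θ hP K₀ g₀ os K t x :=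
  sum_bad_weightAK₁₃_eq θ hP K₀ g₀ os kr _ K t

/-- The bad mass under the floor-volume reading (run B). [bookkeeping] -/
theorem sum_bad_floorVolume_weightBK₁₃_eq (K : ℕ) (t : ℝ) :
    ∑ u ∈ badClassK₁₃ θ K₀ g₀ kr (fun _ x => nK x.1 ≤ largeFieldVolume (cK x.1 + 1) x.2) K t, weightBK₁₃ θ hP K₀ g₀ os kr K t u =
      letI : ∀ Kc, DecidableEq (SiteSeqKey F Kc) := fun _ => Classical.decEq _
      ∑ x ∈ (classSet₁₃ θ K₀ g₀ K).filter
          (fun x => kr K x ∈ badClassK₁₃ θ K₀ g₀ kr (fun _ x => nK x.1 ≤ largeFieldVolume (cK x.1 + 1) x.2) K t), weightB₁₃ θ hP K₀ g₀ os K t x :=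
  sum_bad_weightBK₁₃_eq θ hP K₀ g₀ os kr _ K t

/-- At the reading: the bad class of `crOfRecord₁₃KAt K₀ kr (badKeyReadingOfFloorVolume₁₃ N K₀ c n) sh` at a tuple. [bookkeeping] -/
theorem mem_bad_crOfRecord₁₃KAt_floorVolume_iff (krR : KeyReading₁₃ N K₀) (c n : FloorReading₁₃ N) (sh : ShellSplit₁₃CoPH N K₀) (K : ℕ) (t : ℝ)
    (u : Σ K, SiteSeqKey F (K₀ + K)) :
    u ∈ (crOfRecord₁₃KAt K₀ krR (badKeyReadingOfFloorVolume₁₃ N K₀ c n) sh F θ hP g₀ os).Bad K t ↔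
      u ∈ (crOfRecord₁₃KAt K₀ krR (badKeyReadingOfFloorVolume₁₃ N K₀ c n) sh F θ hP g₀ os).T K ∧
        n F θ hP g₀ os u.1 ≤ largeFieldVolume (c F θ hP g₀ os u.1 + 1) u.2 :=
  mem_badClassK₁₃_iff θ K₀ g₀ _ _ K t u

end Reading

/-! ## §3 Threshold `1` is the level cut one above the floor — at the level window and at the forgiving window -/

section ThresholdOne

variable (θ : Stage13HParams F N) (K₀ : ℕ) (g₀ : ℕ → ℝ) (cK : ℕ → ℕ)

/-- ★ **AT THE LEVEL-WINDOW DIAL, THRESHOLD `1` IS THE LEVEL CUT AT `c + 1`**: the floor-volume bad class with threshold `1` equals the level-cut bad class with cut `c K + 1`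
(`Node00.one_le_largeFieldVolume_windowKey_succ_iff`). [bookkeeping] -/
theorem bad_window_floorVolume_one_eq_cut_succ (K : ℕ) (t : ℝ) :
    badClassK₁₃ θ K₀ g₀ (fun _ x => windowKeySigma F cK x) (fun _ x => 1 ≤ largeFieldVolume (cK x.1 + 1) x.2) K t =
      badClassK₁₃ θ K₀ g₀ (fun _ x => windowKeySigma F cK x) (fun _ x => KeyOldLargeField (cK x.1 + 1) x.2) K t := by
  ext u
  rw [mem_badClassK₁₃_iff, mem_badClassK₁₃_iff]
  refine and_congr_right fun hu => ?_
  obtain ⟨x, -, rfl⟩ := (mem_classSetK₁₃_iff θ K₀ g₀ _ K u).1 hu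
  exact one_le_largeFieldVolume_windowKey_succ_iff (cK x.1) x.2

/-- On the forgiven key, volume `≥ 1` at the level just above the floor ⟺ an old region at cut `c + 1` — the forgiven entry at level `c + 1` is not the whole lattice, i.e. (floor
`≥ 1`, `Node00.keyOldLargeField_forgiveKeyComp_iff`) an un-absorbed birth AT level `c + 1`. [bookkeeping] -/
theorem one_le_largeFieldVolume_forgiveKeyComp_succ_iff {Kc : ℕ} (c : ℕ) (x : SiteSeqKey F Kc) :
    1 ≤ largeFieldVolume (c + 1) (forgiveKeyComp F c x) ↔ KeyOldLargeField (c + 1) (forgiveKeyComp F c x) := by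
  rw [Nat.one_le_iff_ne_zero, ← pos_iff_ne_zero, largeFieldVolume_pos_iff]
  constructor
  · exact fun h => ⟨c + 1, Nat.succ_le_succ (Nat.zero_le c), le_rfl, h⟩
  · rintro ⟨j, h1, hj, hne⟩
    by_cases hjc : j ≤ c
    · exact (hne (forgiveKeyComp_snd_of_le F c x h1 hjc)).elim
    · obtain rfl : j = c + 1 := le_antisymm hj (Nat.succ_le_of_lt (not_le.mp hjc))
      exact hne

/-- ★ **AT THE COMPONENT-WISE FORGIVING DIAL, THRESHOLD `1` IS THE LEVEL CUT AT `c + 1`** likewise. [bookkeeping] -/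
theorem bad_forgive_floorVolume_one_eq_cut_succ (K : ℕ) (t : ℝ) :
    badClassK₁₃ θ K₀ g₀ (fun _ x => forgiveKeyCompSigma F cK x) (fun _ x => 1 ≤ largeFieldVolume (cK x.1 + 1) x.2) K t =
      badClassK₁₃ θ K₀ g₀ (fun _ x => forgiveKeyCompSigma F cK x) (fun _ x => KeyOldLargeField (cK x.1 + 1) x.2) K t := by
  ext u
  rw [mem_badClassK₁₃_iff, mem_badClassK₁₃_iff]
  refine and_congr_right fun hu => ?_
  obtain ⟨x, -, rfl⟩ := (mem_classSetK₁₃_iff θ K₀ g₀ _ K u).1 hu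
  exact one_le_largeFieldVolume_forgiveKeyComp_succ_iff (cK x.1) x.2

/-- The same identity at the NAMED dials of record, per tuple: `windowKeyReading₁₃ K₀ c` … [bookkeeping] -/
theorem bad_windowReading_floorVolume_one_eq_cut_succ (c : FloorReading₁₃ N) (hP : θ.Provisos₁₃CoPH F N) (os : List (ULoop F)) (K : ℕ) (t : ℝ) :
    badClassK₁₃ θ K₀ g₀ (windowKeyReading₁₃ K₀ c F θ hP g₀ os) (badKeyReadingOfFloorVolume₁₃ N K₀ c (fun _ _ _ _ _ _ => 1) F θ hP g₀ os) K t =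
      badClassK₁₃ θ K₀ g₀ (windowKeyReading₁₃ K₀ c F θ hP g₀ os) (badKeyReadingOfCut₁₃ N K₀ (fun K => c F θ hP g₀ os K + 1) F θ hP g₀ os) K t :=
  bad_window_floorVolume_one_eq_cut_succ θ K₀ g₀ (c F θ hP g₀ os) K t

/-- … and `forgiveCompReading₁₃ K₀ c`. [bookkeeping] -/
theorem bad_forgiveReading_floorVolume_one_eq_cut_succ (c : FloorReading₁₃ N) (hP : θ.Provisos₁₃CoPH F N) (os : List (ULoop F)) (K : ℕ) (t : ℝ) :
    badClassK₁₃ θ K₀ g₀ (forgiveCompReading₁₃ K₀ c F θ hP g₀ os) (badKeyReadingOfFloorVolume₁₃ N K₀ c (fun _ _ _ _ _ _ => 1) F θ hP g₀ os) K t =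
      badClassK₁₃ θ K₀ g₀ (forgiveCompReading₁₃ K₀ c F θ hP g₀ os) (badKeyReadingOfCut₁₃ N K₀ (fun K => c F θ hP g₀ os K + 1) F θ hP g₀ os) K t :=
  bad_forgive_floorVolume_one_eq_cut_succ θ K₀ g₀ (c F θ hP g₀ os) K t

end ThresholdOne

end YMDAG.UVSplit

end
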